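import Summits.BirchSwinnertonDyer.Rank1Residual.X2.TorsionComparisonLocal
import Literature.NumberTheory.EllipticCurves.GreenbergSelmer
import HarnessLib

/-!
# Greenberg–Vatsal 2000, Prop. (2.8) WITHOUT `H⁰(ℚ, A[π]) = 0`: the non-primitive Greenberg
# Selmer group of `M[n]` over `L = K̄^H` (e.g. `K_∞`) versus `S^{Σ₀}_M(L)[n]`, kernel `M(L)/n`

HONEST FRAMING (cell `b2b-bsdres`, run/shared/lean/b2b/bsd-rank1-residual/, verbatim in every
file): the goal of the cell is to DELETE the COMBINATION-SHAPED residual classes of the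
Birch–Swinnerton-Dyer formula for ALL analytic-rank `≤ 1` elliptic curves over `ℚ` — "full BSD
formula for every rank `≤ 1` curve in class `C`" assembled STRICTLY from published theorems — so
that the rank-`≤ 1` remainder becomes exactly the CONSTRUCTION-SHAPED classes, which are TYPED
(missing-input `Prop`s), NOT attempted. This is not "finishing BSD". Sub-cell
`b2b-bsdres-eisenstein-p2` (CLASS-OWNERS row "X2"), gen 8: research route; NO CLAIM BEYOND STATED
CLASSES; nothing here changes a label. Every declaration is a definition with a body or a proved
theorem; NO named fact, nothing asserted.

WHAT THIS FILE PROVES (referee R98.2 option (β), flag `GV-Prop28-H0-remark`). Greenberg–Vatsal,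
Invent. Math. 142 (2000) = arXiv:math/9906215, §2: for `Σ ∋ p, ∞` finite, `Σ₀ = Σ − {p, ∞}`, the
NON-PRIMITIVE Greenberg Selmer group `S^{Σ₀}_A(ℚ_∞) = ker (H¹(ℚ_Σ/ℚ_∞, A) → 𝓗_p × 𝓗_∞)`
(pp. 16–17, 23), `𝓗_p = H¹((ℚ_∞)_𝔭, A)/ker(→ H¹(I_𝔭, D))`, `D = A/C`; (p. 25) `S^{Σ₀}_{A[π]}(ℚ_∞)`
"entirely analogous" with `𝓗_ℓ(ℚ_∞, A[π]) = ∏_{η∣ℓ} H¹(I_η, A[π])` (`ℓ ≠ p`), `𝓗_p = H¹(I_p, D[π])`;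
**Prop. (2.8)**: "Let `p` be an odd prime. Assume that `Σ₀ ⊆ Σ − {p, ∞}` contains `Ram(A)`.
Assume that `I_p` acts trivially on `D` and that `H⁰(ℚ, A[π]) = 0`. Then
`S^{Σ₀}_A(ℚ_∞)[π] ≅ S^{Σ₀}_{A[π]}(ℚ_∞)`" — proved via `H¹(ℚ_Σ/ℚ_∞, A[π]) → H¹(ℚ_Σ/ℚ_∞, A)[π]`
("an isomorphism" under `H⁰ = 0`) and "`H¹(I_η, A[π]) → H¹(I_η, A)` is injective because
`H⁰(I_η, A) = A` is divisible … `H¹(I_p, D[π]) → H¹(I_p, D)` is injective because `H⁰(I_p, D) = D`".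
HERE, for ANY number field `K`, normal `H ≤ Γ_K` (fixed field `L`; `H = ker κ` for `L = K_∞`),
discrete `Γ_K`-module `M` with continuous orbit maps, `n`-divisible, Greenberg data `(M⁺_v)_{v∣p}`
with `I_v` TRIVIAL ON `M/M⁺_v`, `M` UNRAMIFIED at the finite `v ∉ Σ₀`, `v ∤ p` — and with NO
hypothesis on `M^H = H⁰(L, M)` (for `M = E[p^∞]`, `L = ℚ_∞`: `M^H = E(ℚ_∞)[p^∞]`):
* `gvSelmer H M p L S₀ = S^{Σ₀}_M(L)` (`Σ₀ = S₀`): classes in `H¹(H, M)` which, conjugated by every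
  `σ ∈ Γ_K` (= at every place of `L` above `v`), are UNRAMIFIED at each finite `v ∉ Σ₀`, `v ∤ p`
  (die in `H¹(H ⊓ I_v, M)`) and satisfy Greenberg's condition at each `v ∣ p` (die in
  `H¹(H ⊓ I_v, M/M⁺_v)`) — GV's group with `Σ := Σ₀ ∪ {p, ∞}`, "unramified outside `Σ`" spelled
  place by place through the inertia groups of the tree's `GreenbergSelmer`, WITHOUT the
  archimedean factor `𝓗_∞` (vacuous for odd `p` and `p`-primary `M`; GV assume `p` odd); it
  contains the tree's primitive `GreenbergSelmer.selmerGroupOver` (`selmerGroupOver_le_gvSelmer`);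
* `torsionData L n` — the induced data `M[n] ∩ M⁺_v` (GV: `C[π] ⊂ A[π]`), graded piece injecting
  `I_v`-equivariantly into `M/M⁺_v` (`grIncl`, GV's `D[π] ⊂ D`): `S^{Σ₀}_{M[n]}(L)` is the SAME
  construction on the Galois module `M[n]` (GV p. 26);
* **`mem_gvSelmer_torsion_iff`**: `c ∈ S^{Σ₀}_{M[n]}(L) ↔ α c ∈ S^{Σ₀}_M(L)`, `α = ι_*`;
* **`gvSelmerQuotientKerEquiv`**: `S^{Σ₀}_{M[n]}(L)/ker α ≃ S^{Σ₀}_M(L) ⊓ H¹(H, M)[n]`, with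
  `ker α ≃ M^H/n·M^H` (`TorsionComparison.kerEquiv`): the exact sequence
  **`0 → M^H/n → S^{Σ₀}_{M[n]}(L) → S^{Σ₀}_M(L)[n] → 0`**;
* **`natCard_gvSelmer_torsion(_of_finite)`**: `#S^{Σ₀}_{M[n]}(L) = #S^{Σ₀}_M(L)[n] · #(M^H/n·M^H)`
  (`= … · #M^H[n]` for finite `M^H`) — for `n = p`, `M = E[p^∞]`, in `𝔽_p`-dimensions:
  **`dim S^{Σ₀}_{E[p]} = dim S^{Σ₀}_{E[p^∞]}[p] + dim E(L)[p]`**, the remark of X1R0-GAPMAP §16.0 /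
  ROUTE-G-REMARK-PROOF Claim R on which the `φ = 1` route-G closures rest;
* **`gvSelmerAlpha_bijective_of_noTorsionInvariants`**: Prop. (2.8) AS PRINTED (finite `M^H` with
  `M^H[n] = 0`, e.g. `H⁰(ℚ_∞, A) = 0`): `α : S^{Σ₀}_{M[n]}(L) ≃ S^{Σ₀}_M(L)[n]`;
* `gvSelmerInfty κ` — the `ℤ_p`-extension spelling (`H = ker κ`).
NOT HERE (printed / typed elsewhere): the second half of Prop. (2.8) (`μ = 0 ⟺` finiteness,
`λ = dim`, via Prop. (2.5)), Cor. (2.3)/Prop. (2.4) (`λ^{Σ₀} = λ + Σ δ_ℓ`), `S_A = Sel_E(ℚ_∞)_p`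
(Greenberg 1999), the trivial zero at `p ‖ N`, the archimedean factor.

References: Greenberg–Vatsal, Invent. Math. 142 (2000) 17–63 = arXiv:math/9906215, §2 pp. 16–17,
23, 25–26; Greenberg, Adv. Stud. Pure Math. 17 (1989), p. 98; Greenberg, LNM 1716 (1999), p. 149
(the comparison "for good, ordinary or multiplicative reduction at `p`", stated without `H⁰ = 0`).
-/

noncomputable section

open scoped Classical AddSubgroup

open NumberField IsDedekindDomain Field
open Literature.NumberTheory.EllipticCurves Literature.NumberTheory.EllipticCurves.GreenbergSelmer
  Literature.NumberTheory.GaloisRepresentations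
  Summit.BirchSwinnertonDyer.Rank1Residual.X2.TorsionComparison

universe u

namespace Summit.BirchSwinnertonDyer.Rank1Residual.X2.GreenbergVatsalTorsion

variable {K : Type u} [Field K] [NumberField K]

/-! ## §1. The non-primitive Greenberg Selmer group `S^{S₀}_M(L)` (finite places) -/

section Defs

variable (H : Subgroup (absoluteGaloisGroup K)) (M : Type u) [AddCommGroup M]
  [DistribMulAction (absoluteGaloisGroup K) M] [TopologicalSpace M] [DiscreteTopology M]

/-- The **unramified condition at the finite place `v`** (chosen place of `L = K̄^H` above `v`): the
kernel of the restriction `H¹(H, M) → H¹(H ⊓ I_v, M)` to the INERTIA group (GV p. 17: "`G_η/I_η`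
has profinite degree prime to `p`. So the last condition is equivalent to `[σ|_{I_η}] = 0`"; p. 25:
`𝓗_ℓ(ℚ_∞, A[π]) = ∏_{η∣ℓ} H¹(I_η, A[π])`; classes unramified at every `η ∤ Σ` are those of
`H¹(ℚ_Σ/ℚ_∞, ·)`). [cite: GreenbergVatsal2000, §2 p. 17 and p. 25] -/
def unramKer (v : HeightOneSpectrum (𝓞 K)) : AddSubgroup (subgroupH1 H M) :=
  (resH1Hom (inertiaInToH H v) (AddMonoidHom.id M) fun _ _ ↦ rfl).ker

/-- The inclusion `H ⊓ I_v → H ⊓ D_v` (from the subgroup `inertiaIn H v` of `D_v` to the subgroup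
`H ⊓ D_v` of `Γ_K`), a continuous homomorphism. [folklore] -/
def inertiaInToInf (v : HeightOneSpectrum (𝓞 K)) :
    inertiaIn H v →ₜ* (H ⊓ decomp v : Subgroup (absoluteGaloisGroup K)) where
  toFun x := ⟨((x : decomp (K := K) v) : absoluteGaloisGroup K),
    ⟨((mem_inertiaIn_iff H v x).1 x.2).1, x.1.2⟩⟩
  map_one' := rfl
  map_mul' _ _ := rfl
  continuous_toFun := (continuous_subtype_val.comp continuous_subtype_val).subtype_mk _

/-- The tree's local condition `awayKer` (die in `H¹(H ⊓ D_v, M)`, decomposition group) implies the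
unramified condition (die in `H¹(H ⊓ I_v, M)`): restrict further along `H ⊓ I_v → H ⊓ D_v`. (GV
p. 17: the two are equivalent over `ℚ_∞` for `p`-primary `M`, "`G_η/I_η` has profinite degree prime
to `p`"; only this inclusion is needed here.) [cite: GreenbergVatsal2000, §2 p. 17] -/
theorem awayKer_le_unramKer (v : HeightOneSpectrum (𝓞 K)) : awayKer H M v ≤ unramKer H M v := by
  intro c hc
  rw [awayKer, AddMonoidHom.mem_ker] at hc
  rw [unramKer, AddMonoidHom.mem_ker]
  have hcomp : resH1Hom (inertiaInToH H v) (AddMonoidHom.id M) (fun _ _ ↦ rfl) =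
      (resH1Hom (inertiaInToInf H v) (AddMonoidHom.id M) (fun _ _ ↦ rfl)).comp
        (resOfLe M (inf_le_left : H ⊓ decomp v ≤ H)) := by
    rw [resOfLe, resH1Hom_comp]
    exact resH1Hom_congr (by ext; rfl) (by ext; rfl) _ _
  rw [hcomp, AddMonoidHom.comp_apply, hc, map_zero]

variable [H.Normal] (p : ℕ) (L : Data K M p) (S₀ : Set (HeightOneSpectrum (𝓞 K)))

/-- **Greenberg–Vatsal's non-primitive Selmer group `S^{S₀}_M(L) ⊆ H¹(H, M)`** of the discrete
`Γ_K`-module `M` over `L = K̄^H`, relative to the Greenberg data `L = (M⁺_v)_{v ∣ p}` and the finite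
set `S₀` of places at which NO condition is imposed (`Σ = S₀ ∪ {v ∣ p} ∪ ∞`): the classes `c` such
that for every `σ ∈ Γ_K` (i.e. at every place of `L` above `v`, cf.
`GreenbergSelmer.selmerGroupOver`)
`conj_σ c` is unramified at each finite `v ∉ S₀` with `v ∤ p` (`unramKer`) and satisfies
Greenberg's condition `res ↦ 0 ∈ H¹(H ⊓ I_v, M/M⁺_v)` at each `v ∣ p` (`greenbergKer`). This is
GV's `S^{S₀}_A(ℚ_∞) = ker (H¹(ℚ_Σ/ℚ_∞, A) → 𝓗_p(ℚ_∞, A) × 𝓗_∞)` (pp. 16–17, 23: "we may therefore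
take `Σ = S₀ ∪ {p, ∞}`. Then, by definition, `S^{S₀}_A(ℚ_∞) = ker (H¹(ℚ_Σ/ℚ_∞, A) → 𝓗_p(ℚ_∞))`")
with the archimedean factor OMITTED (vacuous for odd `p`, GV's standing hypothesis).
[cite: GreenbergVatsal2000, §2 pp. 16–17, 23, 25] -/
def gvSelmer : AddSubgroup (subgroupH1 H M) :=
  (⨅ (v : HeightOneSpectrum (𝓞 K)) (_ : v ∉ S₀) (_ : ((p : ℕ) : 𝓞 K) ∉ v.asIdeal)
      (σ : absoluteGaloisGroup K), (unramKer H M v).comap (conjH1 H M σ)) ⊓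
  ⨅ (v : HeightOneSpectrum (𝓞 K)) (hv : ((p : ℕ) : 𝓞 K) ∈ v.asIdeal) (σ : absoluteGaloisGroup K),
    ((L v hv).greenbergKer H).comap (conjH1 H M σ)

variable {H M p L S₀} in
/-- Membership in `S^{S₀}_M(L)`. [cite: GreenbergVatsal2000, §2 pp. 16–17, 25] -/
theorem mem_gvSelmer_iff (c : subgroupH1 H M) :
    c ∈ gvSelmer H M p L S₀ ↔
      (∀ (v : HeightOneSpectrum (𝓞 K)), v ∉ S₀ → ((p : ℕ) : 𝓞 K) ∉ v.asIdeal →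
          ∀ σ : absoluteGaloisGroup K, conjH1 H M σ c ∈ unramKer H M v) ∧
        ∀ (v : HeightOneSpectrum (𝓞 K)) (hv : ((p : ℕ) : 𝓞 K) ∈ v.asIdeal)
          (σ : absoluteGaloisGroup K), conjH1 H M σ c ∈ (L v hv).greenbergKer H := by
  simp only [gvSelmer, AddSubgroup.mem_inf, AddSubgroup.mem_iInf, AddSubgroup.mem_comap]

/-- `S^{S₀}_M(L)` contains Greenberg's (primitive) Selmer group of the tree
(`GreenbergSelmer.selmerGroupOver`: conditions at ALL places, decomposition groups away from `p`):
dropping the conditions at `S₀` and at `∞` and weakening `D_v` to `I_v` only enlarges the group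
(GV (6): `S_A(ℚ_∞) ⊆ S^{S₀}_A(ℚ_∞)`). [cite: GreenbergVatsal2000, §2 p. 19] -/
theorem selmerGroupOver_le_gvSelmer : selmerGroupOver H M p L ≤ gvSelmer H M p L S₀ := by
  intro c hc
  rw [mem_selmerGroupOver_iff] at hc
  rw [mem_gvSelmer_iff]
  exact ⟨fun v _ hv σ ↦ awayKer_le_unramKer H M v (hc.1 v hv σ), hc.2.2⟩

end Defs

/-! ## §2. The induced Greenberg data on `M[n]` and the injection `M[n]/(M[n] ∩ M⁺) ↪ M/M⁺` -/

section TorsionData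

variable {M : Type u} [AddCommGroup M] [DistribMulAction (absoluteGaloisGroup K) M] {p : ℕ}

/-- **The induced local datum `M[n] ∩ M⁺_v` on the `n`-torsion** (GV p. 25: "Consider the exact
sequence `0 → C[π] → A[π] → D[π] → 0`"). [cite: GreenbergVatsal2000, §2 p. 25] -/
def torsionDatum {v : HeightOneSpectrum (𝓞 K)} (N : LocalDatum K M v) (n : ℕ) :
    LocalDatum K (M[(n : ℤ)]) v where
  plus := N.plus.addSubgroupOf (M[(n : ℤ)])
  smul_mem σ {m} hm := by
    rw [AddSubgroup.mem_addSubgroupOf] at hm ⊢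
    exact N.smul_mem σ hm

/-- The induced Greenberg data `(M[n] ∩ M⁺_v)_{v ∣ p}` on `M[n]`.
[cite: GreenbergVatsal2000, §2 p. 25] -/
def torsionData (L : Data K M p) (n : ℕ) : Data K (M[(n : ℤ)]) p :=
  fun v hv ↦ torsionDatum (L v hv) n

/-- **`κ : M[n]/(M[n] ∩ M⁺_v) → M/M⁺_v`**, induced by `ι : M[n] ↪ M` (GV's `D[π] ⊂ D`).
[cite: GreenbergVatsal2000, §2 p. 25] -/
def grIncl {v : HeightOneSpectrum (𝓞 K)} (N : LocalDatum K M v) (n : ℕ) :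
    (torsionDatum N n).Gr →+ N.Gr :=
  QuotientAddGroup.map (torsionDatum N n).plus N.plus (torsionIncl M n) fun _ hx ↦ hx

/-- `κ` on classes: `κ (m mod M[n] ∩ M⁺) = m mod M⁺`. [folklore] -/
@[simp]
theorem grIncl_grMk {v : HeightOneSpectrum (𝓞 K)} (N : LocalDatum K M v) (n : ℕ)
    (m : M[(n : ℤ)]) : grIncl N n ((torsionDatum N n).grMk m) = N.grMk (m : M) :=
  rfl

/-- `κ` is injective. [cite: GreenbergVatsal2000, §2 p. 25] -/
theorem grIncl_injective {v : HeightOneSpectrum (𝓞 K)} (N : LocalDatum K M v) (n : ℕ) :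
    Function.Injective (grIncl N n) := by
  rw [injective_iff_map_eq_zero]
  intro q hq
  obtain ⟨m, rfl⟩ := (torsionDatum N n).grMk_surjective q
  rw [grIncl_grMk, ← AddMonoidHom.mem_ker, LocalDatum.ker_grMk] at hq
  rw [← AddMonoidHom.mem_ker, LocalDatum.ker_grMk]
  exact hq

/-- `κ` is equivariant for the inertia group `H ⊓ I_v` (indeed for `D_v`). [folklore] -/
theorem grIncl_smul (H : Subgroup (absoluteGaloisGroup K)) {v : HeightOneSpectrum (𝓞 K)}
    (N : LocalDatum K M v) (n : ℕ) (x : inertiaIn H v) (q : (torsionDatum N n).Gr) :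
    grIncl N n (ContinuousMonoidHom.id (inertiaIn H v) x • q) = x • grIncl N n q := by
  obtain ⟨m, rfl⟩ := (torsionDatum N n).grMk_surjective q
  rfl

end TorsionData

/-! ## §3. Local conditions correspond under `α`; the comparison theorems -/

section Main

variable (H : Subgroup (absoluteGaloisGroup K)) [H.Normal] (M : Type u) [AddCommGroup M]
  [DistribMulAction (absoluteGaloisGroup K) M] [TopologicalSpace M] [DiscreteTopology M]
  (p : ℕ) (L : Data K M p) (S₀ : Set (HeightOneSpectrum (𝓞 K))) (n : ℕ)

omit [NumberField K] in
/-- `α` commutes with the conjugation action of `Γ_K` (both composites are the map of the pair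
`(h ↦ σ⁻¹hσ, m ↦ σ • ι m)`). [folklore] -/
theorem conjH1_torsionToH1 (σ : absoluteGaloisGroup K) (c : subgroupH1 H (M[(n : ℤ)])) :
    conjH1 H M σ (torsionToH1 H M n c) = torsionToH1 H M n (conjH1 H (M[(n : ℤ)]) σ c) := by
  rw [conjH1, conjH1, torsionToH1, resH1Hom_resH1Hom, resH1Hom_resH1Hom]
  exact congrFun (congrArg DFunLike.coe (resH1Hom_congr (by ext; rfl) (by ext m; rfl) _ _)) c

omit [H.Normal] in
/-- The unramified condition corresponds under `α` when `I_v` acts trivially on `M`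
(GV: "`H¹(I_η, A[π]) → H¹(I_η, A)` is injective because `H⁰(I_η, A) = A`").
[cite: GreenbergVatsal2000, §2 Prop. (2.8) (proof, p. 25)] -/
theorem mem_unramKer_torsion_iff {v : HeightOneSpectrum (𝓞 K)}
    (hunr : ∀ x ∈ inertia v, ∀ m : M, x • m = m) (c : subgroupH1 H (M[(n : ℤ)])) :
    c ∈ unramKer H (M[(n : ℤ)]) v ↔ torsionToH1 H M n c ∈ unramKer H M v := by
  rw [unramKer, unramKer, AddMonoidHom.mem_ker, AddMonoidHom.mem_ker]
  have htriv : ∀ (x : inertiaIn H v) (m : M), x • m = m := fun x m ↦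
    hunr _ ((mem_inertiaIn_iff H v x.1).1 x.2).2 m
  exact localCondition_iff (Q' := M[(n : ℤ)]) htriv (inertiaInToH H v) (AddMonoidHom.id M)
    (fun _ _ ↦ rfl) (AddMonoidHom.id (M[(n : ℤ)])) (fun _ _ ↦ rfl) (torsionIncl M n)
    (fun _ _ ↦ rfl) (torsionIncl_injective n) (fun _ ↦ rfl) c

omit [H.Normal] in
/-- Greenberg's condition at `v ∣ p` corresponds under `α` when `I_v` acts trivially on `M/M⁺_v`
(GV: "`H¹(I_p, D[π]) → H¹(I_p, D)` is injective because `H⁰(I_p, D) = D`").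
[cite: GreenbergVatsal2000, §2 Prop. (2.8) (proof, p. 25)] -/
theorem mem_greenbergKer_torsion_iff {v : HeightOneSpectrum (𝓞 K)} (N : LocalDatum K M v)
    (htriv : ∀ x ∈ inertia v, ∀ m : M, x • m - m ∈ N.plus) (c : subgroupH1 H (M[(n : ℤ)])) :
    c ∈ (torsionDatum N n).greenbergKer H ↔ torsionToH1 H M n c ∈ N.greenbergKer H := by
  rw [LocalDatum.mem_greenbergKer_iff, LocalDatum.mem_greenbergKer_iff, LocalDatum.greenbergMap,
    LocalDatum.greenbergMap]
  have htriv' : ∀ (x : inertiaIn H v) (q : N.Gr), x • q = q := fun x q ↦ by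
    obtain ⟨m, rfl⟩ := N.grMk_surjective q
    rw [Subgroup.smul_def, LocalDatum.smul_grMk, ← sub_eq_zero, ← map_sub, ← AddMonoidHom.mem_ker,
      LocalDatum.ker_grMk]
    exact htriv _ ((mem_inertiaIn_iff H v x.1).1 x.2).2 m
  exact localCondition_iff htriv' (inertiaInToH H v) N.grMk (fun _ _ ↦ rfl)
    (torsionDatum N n).grMk (fun _ _ ↦ rfl) (grIncl N n) (grIncl_smul H N n)
    (grIncl_injective N n) (fun _ ↦ rfl) c

/-- **The local conditions of `S^{S₀}_{M[n]}(L)` and `S^{S₀}_M(L)` correspond EXACTLY under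
`α = ι_* : H¹(H, M[n]) → H¹(H, M)`**: `c ∈ S^{S₀}_{M[n]}(L) ↔ α c ∈ S^{S₀}_M(L)`, provided `M` is
unramified at the finite `v ∉ S₀`, `v ∤ p`, and `I_v` acts trivially on `M/M⁺_v` at `v ∣ p`
(GV: `S₀ ⊇ Ram(A)`, "`I_p` acts trivially on `D`"). NO hypothesis on `H⁰`.
[cite: GreenbergVatsal2000, §2 Prop. (2.8) (proof, p. 25)] -/
theorem mem_gvSelmer_torsion_iff
    (hunr : ∀ v : HeightOneSpectrum (𝓞 K), v ∉ S₀ → ((p : ℕ) : 𝓞 K) ∉ v.asIdeal →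
      ∀ x ∈ inertia v, ∀ m : M, x • m = m)
    (htriv : ∀ (v : HeightOneSpectrum (𝓞 K)) (hv : ((p : ℕ) : 𝓞 K) ∈ v.asIdeal),
      ∀ x ∈ inertia v, ∀ m : M, x • m - m ∈ (L v hv).plus)
    (c : subgroupH1 H (M[(n : ℤ)])) :
    c ∈ gvSelmer H (M[(n : ℤ)]) p (torsionData L n) S₀ ↔
      torsionToH1 H M n c ∈ gvSelmer H M p L S₀ := by
  rw [mem_gvSelmer_iff, mem_gvSelmer_iff]
  refine and_congr (forall₄_congr fun v hv hvp σ ↦ ?_) (forall₃_congr fun v hv σ ↦ ?_)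
  · rw [conjH1_torsionToH1, mem_unramKer_torsion_iff H M n (hunr v hv hvp)]
  · rw [conjH1_torsionToH1]
    exact mem_greenbergKer_torsion_iff H M n (L v hv) (htriv v hv) _

omit [NumberField K] [H.Normal] [DiscreteTopology M] in
/-- Continuity of the orbit maps of `H` from those of `Γ_K`. [folklore] -/
theorem continuous_smul_subgroup (hM : ∀ m : M, Continuous fun g : absoluteGaloisGroup K ↦ g • m)
    (m : M) : Continuous fun g : H ↦ g • m :=
  (hM m).comp continuous_subtype_val

/-- **The kernel of `α` lies in `S^{S₀}_{M[n]}(L)`** (the connecting classes of `M^H = H⁰(L, M)`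
satisfy every local condition). [cite: GreenbergVatsal2000, §2 Prop. (2.8) (proof, p. 25)] -/
theorem ker_torsionToH1_le_gvSelmer
    (hunr : ∀ v : HeightOneSpectrum (𝓞 K), v ∉ S₀ → ((p : ℕ) : 𝓞 K) ∉ v.asIdeal →
      ∀ x ∈ inertia v, ∀ m : M, x • m = m)
    (htriv : ∀ (v : HeightOneSpectrum (𝓞 K)) (hv : ((p : ℕ) : 𝓞 K) ∈ v.asIdeal),
      ∀ x ∈ inertia v, ∀ m : M, x • m - m ∈ (L v hv).plus) :
    (torsionToH1 H M n).ker ≤ gvSelmer H (M[(n : ℤ)]) p (torsionData L n) S₀ :=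
  ker_le_of_iff _ _ (mem_gvSelmer_torsion_iff H M p L S₀ n hunr htriv)

/-- **`α(S^{S₀}_{M[n]}(L)) = S^{S₀}_M(L) ⊓ H¹(H, M)[n]`** for `n`-divisible `M`.
[cite: GreenbergVatsal2000, §2 Prop. (2.8) (proof, p. 25)] -/
theorem map_gvSelmer_torsion_eq
    (hM : ∀ m : M, Continuous fun g : absoluteGaloisGroup K ↦ g • m)
    (hdiv : ∀ m : M, ∃ m' : M, n • m' = m)
    (hunr : ∀ v : HeightOneSpectrum (𝓞 K), v ∉ S₀ → ((p : ℕ) : 𝓞 K) ∉ v.asIdeal →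
      ∀ x ∈ inertia v, ∀ m : M, x • m = m)
    (htriv : ∀ (v : HeightOneSpectrum (𝓞 K)) (hv : ((p : ℕ) : 𝓞 K) ∈ v.asIdeal),
      ∀ x ∈ inertia v, ∀ m : M, x • m - m ∈ (L v hv).plus) :
    (gvSelmer H (M[(n : ℤ)]) p (torsionData L n) S₀).map (torsionToH1 H M n) =
      gvSelmer H M p L S₀ ⊓ (subgroupH1 H M)[(n : ℤ)] :=
  map_eq_inf_torsionBy _ _ (continuous_smul_subgroup H M hM) hdiv
    (mem_gvSelmer_torsion_iff H M p L S₀ n hunr htriv)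

/-- **The exact sequence `0 → ker α → S^{S₀}_{M[n]}(L) → S^{S₀}_M(L)[n] → 0`** as an isomorphism
`S^{S₀}_{M[n]}(L) / ker α ≃ S^{S₀}_M(L) ⊓ H¹(H, M)[n]`, where `ker α ≃ M^H/n·M^H`
(`TorsionComparison.kerEquiv`; `M^H = H⁰(L, M)`, e.g. `A(K_∞)`). This is Greenberg–Vatsal's
Prop. (2.8) WITHOUT the hypothesis `H⁰ = 0`. [cite: GreenbergVatsal2000, §2 Prop. (2.8)] -/
def gvSelmerQuotientKerEquiv
    (hM : ∀ m : M, Continuous fun g : absoluteGaloisGroup K ↦ g • m)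
    (hdiv : ∀ m : M, ∃ m' : M, n • m' = m)
    (hunr : ∀ v : HeightOneSpectrum (𝓞 K), v ∉ S₀ → ((p : ℕ) : 𝓞 K) ∉ v.asIdeal →
      ∀ x ∈ inertia v, ∀ m : M, x • m = m)
    (htriv : ∀ (v : HeightOneSpectrum (𝓞 K)) (hv : ((p : ℕ) : 𝓞 K) ∈ v.asIdeal),
      ∀ x ∈ inertia v, ∀ m : M, x • m - m ∈ (L v hv).plus) :
    gvSelmer H (M[(n : ℤ)]) p (torsionData L n) S₀ ⧸
        ((torsionToH1 H M n).ker).addSubgroupOf (gvSelmer H (M[(n : ℤ)]) p (torsionData L n) S₀) ≃+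
      (gvSelmer H M p L S₀ ⊓ (subgroupH1 H M)[(n : ℤ)] : AddSubgroup (subgroupH1 H M)) :=
  quotientKerEquiv _ _ (continuous_smul_subgroup H M hM) hdiv
    (mem_gvSelmer_torsion_iff H M p L S₀ n hunr htriv)

/-- **`#S^{S₀}_{M[n]}(L) = #(S^{S₀}_M(L) ⊓ H¹(H, M)[n]) · #(M^H / n·M^H)`** (as `Nat.card`s), for an
`n`-divisible discrete `Γ_K`-module `M` with continuous orbit maps, unramified at the finite
`v ∉ S₀ ∪ {v ∣ p}`, with `I_v` trivial on `M/M⁺_v` at `v ∣ p`; NO hypothesis on `M^H = H⁰(L, M)`.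
[cite: GreenbergVatsal2000, §2 Prop. (2.8) (proof, p. 25)] -/
theorem natCard_gvSelmer_torsion
    (hM : ∀ m : M, Continuous fun g : absoluteGaloisGroup K ↦ g • m)
    (hdiv : ∀ m : M, ∃ m' : M, n • m' = m)
    (hunr : ∀ v : HeightOneSpectrum (𝓞 K), v ∉ S₀ → ((p : ℕ) : 𝓞 K) ∉ v.asIdeal →
      ∀ x ∈ inertia v, ∀ m : M, x • m = m)
    (htriv : ∀ (v : HeightOneSpectrum (𝓞 K)) (hv : ((p : ℕ) : 𝓞 K) ∈ v.asIdeal),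
      ∀ x ∈ inertia v, ∀ m : M, x • m - m ∈ (L v hv).plus) :
    Nat.card (gvSelmer H (M[(n : ℤ)]) p (torsionData L n) S₀) =
      Nat.card (gvSelmer H M p L S₀ ⊓ (subgroupH1 H M)[(n : ℤ)] : AddSubgroup (subgroupH1 H M)) *
        Nat.card (invariants H M ⧸ nsmulInvariants H M n) :=
  natCard_eq _ _ (continuous_smul_subgroup H M hM) hdiv
    (mem_gvSelmer_torsion_iff H M p L S₀ n hunr htriv)

/-- **The `E(K_∞)[p]`-corrected comparison, finite form: `#S^{S₀}_{M[n]}(L) =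
#(S^{S₀}_M(L) ⊓ H¹(H, M)[n]) · #M^H[n]`** when `M^H = H⁰(L, M)` is finite (for `M = E[p^∞]`,
`L = ℚ_∞`: `M^H = E(ℚ_∞)[p^∞]` is finite and `#M^H[p] = #E(ℚ_∞)[p] = p^t`): in `𝔽_p`-dimensions
`dim S^{S₀}_{A[p]}(ℚ_∞) = dim S^{S₀}_A(ℚ_∞)[p] + t` — the remark of X1R0-GAPMAP §16.0 on which the
`φ = 1` route-G closures rest (flag `GV-Prop28-H0-remark`).
[cite: GreenbergVatsal2000, §2 Prop. (2.8) (proof, p. 25)] -/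
theorem natCard_gvSelmer_torsion_of_finite
    (hM : ∀ m : M, Continuous fun g : absoluteGaloisGroup K ↦ g • m)
    (hdiv : ∀ m : M, ∃ m' : M, n • m' = m)
    (hunr : ∀ v : HeightOneSpectrum (𝓞 K), v ∉ S₀ → ((p : ℕ) : 𝓞 K) ∉ v.asIdeal →
      ∀ x ∈ inertia v, ∀ m : M, x • m = m)
    (htriv : ∀ (v : HeightOneSpectrum (𝓞 K)) (hv : ((p : ℕ) : 𝓞 K) ∈ v.asIdeal),
      ∀ x ∈ inertia v, ∀ m : M, x • m - m ∈ (L v hv).plus) [Finite (invariants H M)] :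
    Nat.card (gvSelmer H (M[(n : ℤ)]) p (torsionData L n) S₀) =
      Nat.card (gvSelmer H M p L S₀ ⊓ (subgroupH1 H M)[(n : ℤ)] : AddSubgroup (subgroupH1 H M)) *
        Nat.card ((invariants H M)[(n : ℤ)]) :=
  natCard_eq_of_finite_invariants _ _ (continuous_smul_subgroup H M hM) hdiv
    (mem_gvSelmer_torsion_iff H M p L S₀ n hunr htriv)

/-- **Greenberg–Vatsal's Prop. (2.8) as printed**: if moreover `M^H = H⁰(L, M)` is finite WITHOUT
`n`-torsion (GV: `H⁰(ℚ, A[π]) = 0`, whence `H⁰(ℚ_∞, A) = 0` as `Γ` is pro-`p`), then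
`α : S^{S₀}_{M[n]}(L) → S^{S₀}_M(L) ⊓ H¹(H, M)[n]` is a BIJECTION
("`S^{S₀}_A(ℚ_∞)[π] ≅ S^{S₀}_{A[π]}(ℚ_∞)`"). [cite: GreenbergVatsal2000, §2 Prop. (2.8)] -/
theorem gvSelmerAlpha_bijective_of_noTorsionInvariants
    (hM : ∀ m : M, Continuous fun g : absoluteGaloisGroup K ↦ g • m)
    (hdiv : ∀ m : M, ∃ m' : M, n • m' = m)
    (hunr : ∀ v : HeightOneSpectrum (𝓞 K), v ∉ S₀ → ((p : ℕ) : 𝓞 K) ∉ v.asIdeal →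
      ∀ x ∈ inertia v, ∀ m : M, x • m = m)
    (htriv : ∀ (v : HeightOneSpectrum (𝓞 K)) (hv : ((p : ℕ) : 𝓞 K) ∈ v.asIdeal),
      ∀ x ∈ inertia v, ∀ m : M, x • m - m ∈ (L v hv).plus) [Finite (invariants H M)]
    (h0 : ∀ m ∈ invariants H M, n • m = 0 → m = 0) :
    Function.Bijective (alphaOn (gvSelmer H M p L S₀)
      (gvSelmer H (M[(n : ℤ)]) p (torsionData L n) S₀)
      (mem_gvSelmer_torsion_iff H M p L S₀ n hunr htriv)) :=
  alphaOn_bijective_of_noTorsionInvariants _ _ (continuous_smul_subgroup H M hM) hdiv _ h0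

end Main

/-! ## §4. Over a `ℤ_p`-extension `K_∞ = K̄^{ker κ}` -/

section Tower

variable {p : ℕ} [Fact p.Prime] (κ : ZpExtension K p) (M : Type u) [AddCommGroup M]
  [DistribMulAction (absoluteGaloisGroup K) M] [TopologicalSpace M] [DiscreteTopology M]
  (L : Data K M p) (S₀ : Set (HeightOneSpectrum (𝓞 K)))

/-- **`S^{S₀}_M(K_∞)`**: the non-primitive Greenberg Selmer group over the top of the
`ℤ_p`-extension `κ` (`H = ker κ = Gal(K̄/K_∞)`), the object of GV §2 for `K = ℚ`, `κ` cyclotomic.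
[cite: GreenbergVatsal2000, §2 pp. 16–17] -/
def gvSelmerInfty : AddSubgroup (subgroupH1 κ.kerSubgroup M) :=
  gvSelmer κ.kerSubgroup M p L S₀

end Tower

end Summit.BirchSwinnertonDyer.Rank1Residual.X2.GreenbergVatsalTorsion

end
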